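import Summits.ABC.IUTFork.Joshi.RosettaIndeterminacies
import Summits.ABC.IUTFork.Joshi.Dictionary
import Mathlib.Tactic.Ring
import HarnessLib

/-!
# Block-E dictionary topic file: Joshi's §8.11 indeterminacy MOVES ([J-III] = arXiv:2401.13508v4 §8.11, Rosetta Stone
# Fragment 5) bound to OUR frozen (Ind1)/(Ind2) families of [IUTchIII] Thm 3.11 (i) and to the seed `Joshi/Dictionary.lean`

Dictionary-topic file of the abc-iut cell, branch E «type Joshi's construction, test vs S» (rung LADDER-ABC:A2.E; seat
abc-iut-E-t18, slot T-18; E-PLAN R14: OUR frozen `Thm311*`/`Cor312*` decls are imported only by `Joshi/Dictionary*.lean` /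
`Joshi/Test*.lean`). **No side is taken** on [IUTchIII] Cor. 3.12, on Joshi's claims, or on Mochizuki's report on them; typed ≠
proved ≠ endorsed; Joshi's papers are unrefereed preprints. NOTHING about the q- or Θ-pilots is decided here and no TEST line is
filed from this file (plan/E/README.md §5: shape ruling first).

WHAT IS HERE. The object file `Joshi/RosettaIndeterminacies.lean` (§7 there) declares OUR READING of the binding as DATA:
`ATS3.placewiseFamily L g` (a place-indexed automorphism of the local containers `log(D⊢_v)` acting on every tensor factor and
summand of Mochizuki's packets), `ATS3.IndDictionary 𝔍 L` (`placeOf` D-01, `carrierAut` = Fragment 5 row 4 / D-08: how Joshi's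
Ind2 element `σ ∈ Aut_{Z_p}(Ĝ_m(O_{C♭_p}))` ([J-III] p.91 l.38–43; [J-I] Thm 5.21.1 (3)) acts on OUR container, `anabAut` = D-04: how
an anabelomorph of `L_v` (his Ind1, p.92 l.18–23) does, `colIndex` = row 1 / D-07), the move type `JMove` and its realisation
`toPacketAut`, and the two CANDIDATE dictionary hypotheses `JInd2InIsm` («the induced container automorphisms lie in Mochizuki's
Ism», [IUTchIII] Thm 3.11 (i) (Ind2) «independent copies of Ism»; [IUTchII] Ex 1.8 (iv) «Ism(G) … the compact topological group of
G-isometries of O^{×μ}(G)», locator EL-079 of plan/E/lit/OBJECT-LOCATORS.tsv) and `JInd1InStripAut` («… are induced by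
isomorphisms of D⊢-prime-strips», (Ind1)). This file PROVES: (§1) a placewise family of `Ism`-elements (resp. strip-automorphisms)
IS an (Ind2)- (resp. (Ind1)-) family (`Thm311.LogShells.Ind2Family` / `Ind1Family`, BY NAME); (§2) hence under `JInd2InIsm ∧
JInd1InStripAut` every finite composite of Joshi's §8.11 moves acts on the packets through `Subgroup.closure (L.Ind1Family ∪
L.Ind2Family)` (`prod_toPacketAut_mem_closure`) — the subgroup S = `Cor312Vol.PilotKummerIndRelated` quantifies over via `S.RLGP`;
weak non-vacuity (the trivial dictionary satisfies both); the Ind3 move only shifts the column index (D-07); (§3) GLUE TO THE SEED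
`Joshi.Dictionary S` (E-PLAN R10, p428775): if every move of a seed dictionary FACTORS through finitely many §8.11 moves
(`FactorsThrough`), then `JInd2InIsm ∧ JInd1InStripAut ⟹ Joshi.MovesAreInd` (the load-bearing half of Y1 =
`Joshi.AnsatzWithinInd`, E-PLAN §2), and Y1 itself follows with the seed's other three components (`ansatzWithinInd_of_factorsThrough`,
kernel glue via the seed's `ansatzWithinInd_of_moves`). So the T-18 contribution to the branch-E test is located in ONE place: whether
a CONTENTFUL instantiation satisfies `JInd2InIsm` — Joshi's σ range over all topological linear automorphisms of the Banach space
`𝒢(O_F) ≅ B^{φ=p}` ([J-I] Thm 5.21.1 (3)), Mochizuki's (Ind2) over the isometry group Ism — is the X-02 / X-07 question of E-cx /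
E-t32, not answered here. [claim: Joshi2024ATS3, status: disputed] [claim: Joshi2021ATS1, status: disputed]; our side
[claim: Mochizuki2012, status: disputed]. Standard axioms only; no instance, no notation, no new `Prop` fact.
-/

noncomputable section

namespace Summit.ABC.IUTFork.Joshi.ATS3

open Function Set Thm311

variable {T : ThetaIndex}

/-! ## 1. Placewise families are (Ind2)- / (Ind1)-families -/

/-- A placewise family of elements of `Ism` is an (Ind2)-family ([IUTchIII] Thm 3.11 (i) (Ind2) «independent copies of
Ism … on each of the direct summands of the j+1 factors»). [claim: Mochizuki2012, status: disputed] -/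
theorem placewiseFamily_mem_Ind2Family (L : LogShells T) {g : ∀ v : T.V, L.carrier v ≃ₗ[ℚ] L.carrier v}
    (hg : ∀ v, g v ∈ L.ism v) : placewiseFamily L g ∈ L.Ind2Family :=
  fun _ _ => ⟨fun _ v => g v.1, fun _ v => hg v.1, rfl⟩

/-- A placewise family of strip-automorphisms is an (Ind1)-family (identity permutation of the capsule) ([IUTchIII] Thm
3.11 (i) (Ind1) «automorphisms of the procession of D⊢-prime-strips»). [claim: Mochizuki2012, status: disputed] -/
theorem placewiseFamily_mem_Ind1Family (L : LogShells T) {g : ∀ v : T.V, L.carrier v ≃ₗ[ℚ] L.carrier v}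
    (hg : ∀ v, g v ∈ L.stripAut v) : placewiseFamily L g ∈ L.Ind1Family := fun j =>
  ⟨Equiv.refl _, fun _ v => g v, fun _ v => hg v, fun vQ => by
    rw [L.permute_refl]
    rfl⟩

/-! ## 2. Joshi's §8.11 moves act through the indeterminacy subgroup (under the candidate hypotheses) -/

namespace IndDictionary

variable {𝔍 : RosettaIndDatum} {L : LogShells T} (𝔇 : IndDictionary 𝔍 L)

/-- Under `JInd2InIsm`, a Joshi Ind2 element acts on the packets through an (Ind2)-family. DERIVED. [claim: Mochizuki2012, status: disputed] -/
theorem toPacketAut_inl_mem_Ind2Family (h2 : 𝔇.JInd2InIsm) (v : 𝔍.V) (σ : 𝔍.AutG v) :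
    𝔇.toPacketAut ⟨v, .inl σ⟩ ∈ L.Ind2Family :=
  placewiseFamily_mem_Ind2Family L (h2 v σ)

/-- Under `JInd1InStripAut`, a Joshi Ind1 move acts on the packets through an (Ind1)-family. DERIVED. [claim: Mochizuki2012, status: disputed] -/
theorem toPacketAut_inr_mem_Ind1Family (h1 : 𝔇.JInd1InStripAut) (v : 𝔍.V) (E' : ↥(𝔍.JInd1 v)) :
    𝔇.toPacketAut ⟨v, .inr E'⟩ ∈ L.Ind1Family :=
  placewiseFamily_mem_Ind1Family L (h1 v E')

/-- Under both candidate hypotheses every Joshi move acts through `Ind1Family ∪ Ind2Family`. DERIVED. [claim: Mochizuki2012, status: disputed] -/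
theorem toPacketAut_mem_union (h2 : 𝔇.JInd2InIsm) (h1 : 𝔇.JInd1InStripAut) (μ : JMove 𝔍) :
    𝔇.toPacketAut μ ∈ L.Ind1Family ∪ L.Ind2Family := by
  obtain ⟨v, σ | E'⟩ := μ
  · exact Or.inr (𝔇.toPacketAut_inl_mem_Ind2Family h2 v σ)
  · exact Or.inl (𝔇.toPacketAut_inr_mem_Ind1Family h1 v E')

/-- **The closure theorem (T-18's half of Y1)**: under `JInd2InIsm ∧ JInd1InStripAut`, every finite composite of Joshi moves
acts on Mochizuki's tensor packets through an element of `Subgroup.closure (L.Ind1Family ∪ L.Ind2Family)` — the subgroup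
over which S = `Cor312Vol.PilotKummerIndRelated` / `PilotKummerCompat` quantify (via `S.RLGP`). DERIVED; it binds nothing
about the q- and Θ-pilots (that is the test file's business, after the shape ruling). [claim: Mochizuki2012, status: disputed] -/
theorem prod_toPacketAut_mem_closure (h2 : 𝔇.JInd2InIsm) (h1 : 𝔇.JInd1InStripAut) (l : List (JMove 𝔍)) :
    (l.map 𝔇.toPacketAut).prod ∈ Subgroup.closure (L.Ind1Family ∪ L.Ind2Family) := by
  refine list_prod_mem fun Φ hΦ => ?_
  obtain ⟨μ, -, rfl⟩ := List.mem_map.1 hΦ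
  exact Subgroup.subset_closure (𝔇.toPacketAut_mem_union h2 h1 μ)

/-- In particular a single Joshi move lands in the indeterminacy subgroup. [claim: Mochizuki2012, status: disputed] -/
theorem toPacketAut_mem_closure (h2 : 𝔇.JInd2InIsm) (h1 : 𝔇.JInd1InStripAut) (μ : JMove 𝔍) :
    𝔇.toPacketAut μ ∈ Subgroup.closure (L.Ind1Family ∪ L.Ind2Family) :=
  Subgroup.subset_closure (𝔇.toPacketAut_mem_union h2 h1 μ)

/-- The trivial dictionary (every Joshi move acts as the identity on our containers) satisfies both candidate hypotheses —
NON-VACUITY in the weak sense only: the hypotheses are satisfiable, trivially; whether a CONTENTFUL dictionary satisfies them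
is the test question (E-cx). [folklore] -/
theorem trivial_satisfies (placeOf : 𝔍.V → T.V) (colIndex : 𝔍.GlobalPt → ℤ) :
    (⟨placeOf, fun _ _ w => LinearEquiv.refl ℚ (L.carrier w), fun _ _ w => LinearEquiv.refl ℚ (L.carrier w), colIndex⟩ :
        IndDictionary 𝔍 L).JInd2InIsm ∧
      (⟨placeOf, fun _ _ w => LinearEquiv.refl ℚ (L.carrier w), fun _ _ w => LinearEquiv.refl ℚ (L.carrier w), colIndex⟩ :
        IndDictionary 𝔍 L).JInd1InStripAut :=
  ⟨fun _ _ w => L.one_mem_ism w, fun _ _ w => L.one_mem_stripAut w⟩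

/-- Under `LogLinkIsColumnStep` the `n`-th vertex of Joshi's column sits `n` steps up the vertical line (Rmk 8.9.2 (1);
D-07: our (Ind3) = the index `m` of `Column.frobΨ m`). DERIVED. [claim: Joshi2024ATS3, status: disputed] -/
theorem colIndex_logLinkColumn (h : 𝔇.LogLinkIsColumnStep) (y : 𝔍.GlobalPt) (n : ℕ) :
    𝔇.colIndex (𝔍.logLinkColumn y n) = 𝔇.colIndex y + n := by
  induction n with
  | zero => simp [RosettaIndDatum.logLinkColumn]
  | succ n ih =>
      have hs : 𝔍.logLinkColumn y (n + 1) = 𝔍.logLink (𝔍.logLinkColumn y n) :=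
        Function.iterate_succ_apply' 𝔍.frob n y
      rw [hs, h, ih]; push_cast; ring

/-- Under `LogLinkIsColumnStep`, Joshi's Ind3-move (same column) changes only the column index: Ind3-related points have
indices differing by an integer shift realised along the column (D-07). DERIVED. [claim: Joshi2024ATS3, status: disputed] -/
theorem colIndex_of_jInd3 (h : 𝔇.LogLinkIsColumnStep) {y y' : 𝔍.GlobalPt} (hy : 𝔍.JInd3 y y') :
    ∃ n : ℕ, 𝔇.colIndex y' = 𝔇.colIndex y + n ∨ 𝔇.colIndex y = 𝔇.colIndex y' + n := by
  obtain ⟨n, h' | h'⟩ := hy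
  · exact ⟨n, Or.inl (by rw [← h', 𝔇.colIndex_logLinkColumn h])⟩
  · exact ⟨n, Or.inr (by rw [← h', 𝔇.colIndex_logLinkColumn h])⟩


/-! ## 3. Glue to the seed dictionary `Joshi.Dictionary S` (E-PLAN R10): `MovesAreInd` and Y1 from the §8.11 moves -/

variable {S : LatticeSituation T} {𝔍' : RosettaIndDatum} (𝔇' : IndDictionary 𝔍' S.L) (𝔈 : Joshi.Dictionary S)

/-- **`FactorsThrough`** (OUR READING, untagged): every move of the seed dictionary `𝔈` — Joshi's Ind1/Ind2/Ind3 moves and the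
collation isomorphisms of [J-III] Prop 9.7.5.1, as E-PLAN R10 reads `𝔈.Move` — is realised on Mochizuki's tensor packets as a
finite composite of the realisations of §8.11 generators (Ind2 elements `σ`, anabelomorphs `E′`) through the T-18 dictionary `𝔇'`
(an Ind3 move contributes the empty composite: it shifts the column index only, D-07). Candidate hypothesis relating the two
dictionaries; never asserted. [claim: Joshi2024ATS3, status: disputed] -/
def FactorsThrough : Prop :=
  ∀ g : 𝔈.Move, ∃ l : List (JMove 𝔍'), 𝔈.real g = (l.map 𝔇'.toPacketAut).prod

/-- **T-18's half of Y1**: if the seed's moves factor through the §8.11 moves, then `JInd2InIsm ∧ JInd1InStripAut` give the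
seed's `Joshi.MovesAreInd` (every move realised inside `Subgroup.closure (Ind1Family ∪ Ind2Family)`). Kernel glue only.
[claim: Mochizuki2012, status: disputed] -/
theorem movesAreInd_of_factorsThrough (h2 : 𝔇'.JInd2InIsm) (h1 : 𝔇'.JInd1InStripAut) (hf : FactorsThrough 𝔇' 𝔈) :
    Joshi.MovesAreInd 𝔈 := fun g => by
  obtain ⟨l, hl⟩ := hf g
  rw [hl]
  exact 𝔇'.prod_toPacketAut_mem_closure h2 h1 l

/-- **Y1 `Joshi.AnsatzWithinInd` from the §8.11 moves**: base anchoring + equivariant collation + reachability of the standard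
point (the seed's components) + factorisation through §8.11 moves + the two T-18 candidate hypotheses ⟹ Y1, via the seed's
`ansatzWithinInd_of_moves`. Kernel glue only; no Joshi claim and no clause of Cor. 3.12 is asserted, and S is NOT concluded here
(that needs the seed's `StandardPointIsQPilot`, graded STRONGER-THAN-PRINT, E-PLAN R15 — a Test-file matter).
[claim: Joshi2024ATS3, status: disputed] -/
theorem ansatzWithinInd_of_factorsThrough {P : Cor312.Setting S.toSituation}
    (ρ : (∀ v : T.V, v ∈ T.Vbad → Set (S.L.StarPacket v)) → ∀ (j : T.Label) (vQ : T.VQ), Set (S.L.Packet j vQ))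
    (hB : Joshi.BaseIsThetaPilot 𝔈 (P := P)) (hE : Joshi.DatumEquivariant 𝔈) (hR : Joshi.StdReachable 𝔈)
    (h2 : 𝔇'.JInd2InIsm) (h1 : 𝔇'.JInd1InStripAut) (hf : FactorsThrough 𝔇' 𝔈) :
    Joshi.AnsatzWithinInd ρ 𝔈 (P := P) :=
  Joshi.ansatzWithinInd_of_moves ρ 𝔈 hB (movesAreInd_of_factorsThrough 𝔇' 𝔈 h2 h1 hf) hE hR

/-- **The seed dictionary GENERATED by a T-18 dictionary**: moves := the §8.11 moves `JMove 𝔍'`, realisation := `toPacketAut`;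
the Joshi-side data (Ansatz points, action, base/standard point, Kummer data `Ξ_z`) are supplied by the caller (slots T-07/T-08/
T-11/T-22). DATA only. [claim: Joshi2024ATS3, status: disputed] -/
def toDictionary (Pt : Type) (act : JMove 𝔍' → Pt → Pt) (base std : Pt)
    (datum : Pt → ∀ v : T.V, v ∈ T.Vbad → Set (S.L.StarPacket v)) : Joshi.Dictionary S :=
  ⟨Pt, JMove 𝔍', act, base, std, datum, 𝔇'.toPacketAut⟩

/-- The generated seed dictionary factors through itself (each move is the one-element composite). [folklore] -/
theorem factorsThrough_toDictionary (Pt : Type) (act : JMove 𝔍' → Pt → Pt) (base std : Pt)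
    (datum : Pt → ∀ v : T.V, v ∈ T.Vbad → Set (S.L.StarPacket v)) :
    FactorsThrough 𝔇' (𝔇'.toDictionary Pt act base std datum) := fun g =>
  ⟨[g], by simp [toDictionary]⟩

/-- For the generated seed dictionary, `JInd2InIsm ∧ JInd1InStripAut ⟹ MovesAreInd` outright. [claim: Mochizuki2012, status: disputed] -/
theorem movesAreInd_toDictionary (h2 : 𝔇'.JInd2InIsm) (h1 : 𝔇'.JInd1InStripAut) (Pt : Type)
    (act : JMove 𝔍' → Pt → Pt) (base std : Pt) (datum : Pt → ∀ v : T.V, v ∈ T.Vbad → Set (S.L.StarPacket v)) :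
    Joshi.MovesAreInd (𝔇'.toDictionary Pt act base std datum) :=
  movesAreInd_of_factorsThrough 𝔇' _ h2 h1 (factorsThrough_toDictionary 𝔇' Pt act base std datum)

end IndDictionary

/-! ## 4. The Thm 8.8.3 reading (E-t17's observation 07:36Z): Joshi's moves act through PRIME-STRIP isomorphisms — move-wise disjunction (appended) -/

namespace IndDictionary

variable {𝔍 : RosettaIndDatum} {L : LogShells T} (𝔇 : IndDictionary 𝔍 L)

/-- The place-indexed container automorphisms underlying a §8.11 move, before realisation on the packets. [claim: Joshi2024ATS3, status: disputed] -/
def gen : JMove 𝔍 → ∀ w : T.V, L.carrier w ≃ₗ[ℚ] L.carrier w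
  | ⟨v, .inl σ⟩ => 𝔇.carrierAut v σ
  | ⟨v, .inr E'⟩ => 𝔇.anabAut v E'

/-- Realisation = the placewise family of the underlying automorphisms. [folklore] -/
theorem toPacketAut_eq_placewiseFamily (μ : JMove 𝔍) : 𝔇.toPacketAut μ = placewiseFamily L (𝔇.gen μ) := by
  obtain ⟨v, σ | E'⟩ := μ <;> rfl

/-- **Candidate dictionary hypothesis `JInd2InStripAut` (OUR READING of [J-III] Thm 8.8.3, p.88 l.26 – p.89 l.29, as observed by E-t17):**
for each of Joshi's moves σ — «any of the actions on 𝒴_L established in [ATS II½ Thm 4.2.3 / Cor 4.2.5]», i.e. Galois, global Frobenius,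
`Aut(Ĝ_m(O_{C♭_p}))` — Thm 8.8.3 asserts an ISOMORPHISM OF PRIME-STRIPS (8.8.4) `G_{L_v} ↷ O^{×μ}_{L̄_v} ⥲ G_{L^σ_v} ↷ O^{×μ}_{L̄^σ_v}`; on
Mochizuki's side that is an (Ind1)-TYPE datum: the induced container automorphism lies in `stripAut` («automorphisms of log(D⊢_v) induced by
isomorphisms of D⊢-prime-strips»). The alternative to `JInd2InIsm` for the Ind2 half; never asserted. [claim: Joshi2024ATS3, status: disputed] -/
def JInd2InStripAut : Prop := ∀ (v : 𝔍.V) (σ : 𝔍.AutG v) (w : T.V), 𝔇.carrierAut v σ w ∈ L.stripAut w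

/-- **`JMovesInInd` — the weakest T-18 hypothesis**: move by move, the underlying container automorphisms are (Ind1)-generators at every
place OR (Ind2)-generators at every place (cf. D-10's `CollationInInd`). [claim: Joshi2024ATS3, status: disputed] -/
def JMovesInInd : Prop :=
  ∀ μ : JMove 𝔍, (∀ w : T.V, 𝔇.gen μ w ∈ L.stripAut w) ∨ (∀ w : T.V, 𝔇.gen μ w ∈ L.ism w)

/-- The original pair of hypotheses gives the disjunctive one. [folklore] -/
theorem jMovesInInd_of_hyps (h2 : 𝔇.JInd2InIsm) (h1 : 𝔇.JInd1InStripAut) : 𝔇.JMovesInInd := by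
  rintro ⟨v, σ | E'⟩
  · exact Or.inr (h2 v σ)
  · exact Or.inl (h1 v E')

/-- The Thm 8.8.3 reading of the Ind2 half (with the Ind1 half as before) gives the disjunctive one. [folklore] -/
theorem jMovesInInd_of_stripAut (h2 : 𝔇.JInd2InStripAut) (h1 : 𝔇.JInd1InStripAut) : 𝔇.JMovesInInd := by
  rintro ⟨v, σ | E'⟩
  · exact Or.inl (h2 v σ)
  · exact Or.inl (h1 v E')

/-- Under `JMovesInInd` every §8.11 move acts through `Ind1Family ∪ Ind2Family`. DERIVED. [claim: Mochizuki2012, status: disputed] -/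
theorem toPacketAut_mem_union_of_movesInInd (h : 𝔇.JMovesInInd) (μ : JMove 𝔍) :
    𝔇.toPacketAut μ ∈ L.Ind1Family ∪ L.Ind2Family := by
  rw [𝔇.toPacketAut_eq_placewiseFamily]
  rcases h μ with h1 | h2
  · exact Or.inl (placewiseFamily_mem_Ind1Family L h1)
  · exact Or.inr (placewiseFamily_mem_Ind2Family L h2)

/-- **Closure theorem under the weakest hypothesis**: `JMovesInInd ⟹` every finite composite of §8.11 moves acts on the packets through
`Subgroup.closure (Ind1Family ∪ Ind2Family)`. DERIVED. [claim: Mochizuki2012, status: disputed] -/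
theorem prod_toPacketAut_mem_closure_of_movesInInd (h : 𝔇.JMovesInInd) (l : List (JMove 𝔍)) :
    (l.map 𝔇.toPacketAut).prod ∈ Subgroup.closure (L.Ind1Family ∪ L.Ind2Family) := by
  refine list_prod_mem fun Φ hΦ => ?_
  obtain ⟨μ, -, rfl⟩ := List.mem_map.1 hΦ
  exact Subgroup.subset_closure (𝔇.toPacketAut_mem_union_of_movesInInd h μ)

variable {S : LatticeSituation T} {𝔍' : RosettaIndDatum} (𝔇' : IndDictionary 𝔍' S.L) (𝔈 : Joshi.Dictionary S)

/-- **`MovesAreInd` under the weakest T-18 hypothesis**: `JMovesInInd ∧ FactorsThrough ⟹ Joshi.MovesAreInd` — so the Thm 8.8.3 reading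
(`JInd2InStripAut`) serves the X-01 line exactly as `JInd2InIsm` does; at volume-invariant instantiations both are refuted alike (X-06 ranges over
`Ind1Family ∪ Ind2Family`), at the pinned countermodel `stripAut = ism = {±1}`. Kernel glue. [claim: Mochizuki2012, status: disputed] -/
theorem movesAreInd_of_movesInInd (h : 𝔇'.JMovesInInd) (hf : 𝔇'.FactorsThrough 𝔈) : Joshi.MovesAreInd 𝔈 := fun g => by
  obtain ⟨l, hl⟩ := hf g
  rw [hl]
  exact 𝔇'.prod_toPacketAut_mem_closure_of_movesInInd h l

/-- Y1 from the weakest hypothesis and the seed's components. Kernel glue. [claim: Joshi2024ATS3, status: disputed] -/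
theorem ansatzWithinInd_of_movesInInd {P : Cor312.Setting S.toSituation}
    (ρ : (∀ v : T.V, v ∈ T.Vbad → Set (S.L.StarPacket v)) → ∀ (j : T.Label) (vQ : T.VQ), Set (S.L.Packet j vQ))
    (hB : Joshi.BaseIsThetaPilot 𝔈 (P := P)) (hE : Joshi.DatumEquivariant 𝔈) (hR : Joshi.StdReachable 𝔈)
    (h : 𝔇'.JMovesInInd) (hf : 𝔇'.FactorsThrough 𝔈) : Joshi.AnsatzWithinInd ρ 𝔈 (P := P) :=
  Joshi.ansatzWithinInd_of_moves ρ 𝔈 hB (𝔇'.movesAreInd_of_movesInInd 𝔈 h hf) hE hR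

end IndDictionary

end Summit.ABC.IUTFork.Joshi.ATS3

end
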